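import Literature.Geometry.Lorentzian.NearKerrLeafMinkowski
import HarnessLib

/-!
# Near-Kerr leaves are not crossed by every inertial observer (Minkowski space)

Companion of `NearKerrLeafMinkowski.lean` (the time-stretched hyperboloid
`stretchLeaf a = {y⁰ = a √(1 + |y̲|²)}`, `a = √(1 + ε)`, is an `(ε, k)`-near-Kerr leaf of the
Minkowski development with `0` holes for every `ε > 0`, and is not achronal). This file records the
consequence that matters for every route item CONCLUDING `∃ S', IsNearKerrLeaf k ε N M a S' ∧ …`
(crux `BondiBartnikRigidity` and `GapExhaustion` of route `FinalStateConjecture/BartnikGapSettling`,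
`QuietLeaves`/`Capture` of `QuietWindowCapture`): an `(ε, k)`-near-Kerr leaf need NOT be met by every
inertial observer living in its own chronological future — the "sweeping" property (Q) of the crux
dossier `Summits/FinalStateConjecture/FinalStateConjecture/Cruxes/BondiBartnikRigidity/ADDENDUM-a1.md`
fails. Precisely (`line_not_mem_stretchLeaf`): for `a > 1` the straight timelike world-line
`t ↦ (t, x̲₀ + t V)` with `a ‖V‖ > 1` (speed above `(1 + ε)^{-1/2}`, still `< 1` is allowed) and
`⟪x̲₀, V⟫ ≥ 0` (receding) never meets `stretchLeaf a`: for `t ≤ 0` the leaf time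
`a √(1 + |x̲|²) ≥ a > 0 ≥ t`, and for `t > 0`, `a √(1 + |x̲₀ + tV|²) > a |x̲₀ + tV| ≥ a t ‖V‖ > t`.
Yet this observer is an honest one: it lies in `J⁺` of the data slice from `t = 0` on, it is in the
causal past of the leaf at all times (`J⁻(stretchLeaf a) = E4`), and it is in the CHRONOLOGICAL FUTURE
of the leaf from some time on (`line_mem_chronologicalFuture_stretchLeaf`, through the tip `(a, 0)`).
Packaged: `exists_isNearKerrLeaf_missed_by_inertialObserver`.

Physical reading (for the planners; the boost is Lorentz symmetry of `ℝ⁴₁`, not formalised here): by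
boosting this leaf with rapidity `> artanh (1/a) ≈ ½ log (8/ε)` and translating it into the future of
any event `p`, one obtains an `(ε, k)`-leaf `S' ⊆ J⁺(p)` that avoids the world-line of an observer AT
REST — e.g. the world-tube of a small black hole or of a focal region of incoming radiation — for all
times, while its honest unit core sits far out on `p`'s light cone where the field is weak. So a
conclusion `∃ S', IsNearKerrLeaf k ε 0 … S' ∧ S' ⊆ J⁺(S)` cannot certify that `S'` "sees" a compact
strong-field region: the unweighted Cartesian `Cᵏ` tolerance lets the leaf turn timelike beyond
coordinate radius `ε^{-1/2}` (`exists_isNearKerrLeaf_not_achronal`) and outrun any slower obstacle.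
An ACHRONAL leaf (an entire graph of Lipschitz constant `≤ 1` over `ℝ³`) is crossed by every complete
inertial observer; that clause, or a frame-adapted (weighted) deviation, is what a repaired leaf
predicate needs.

## References

* B. O'Neill, *Semi-Riemannian geometry*, Academic Press 1983, Ch. 14, p. 402 (causality of `ℝ⁴₁`:
  `I⁺(p)`, `J⁺(p)` are the open/closed solid cones). [ONeillSemiRiemannian1983]
* M. Dafermos, G. Holzegel, I. Rodnianski, M. Taylor, arXiv:2104.08222, §1 (the chart/deviation
  vocabulary behind `IsNearKerrLeaf`). [DafermosHolzegelRodnianskiTaylor2021]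
-/

noncomputable section

open Set TopologicalSpace Filter Function
open scoped Manifold ContDiff Topology ENNReal

namespace Literature.Geometry.Lorentzian

namespace Minkowski

/-! ### Membership in the stretched leaf -/

/-- A point lies on the stretched leaf `stretchLeaf a` iff its time is `a √(1 + |y̲|²)`
(the leaf is the graph of `y̲ ↦ a √(1 + |y̲|²)`; O'Neill 1983, Ch. 14, p. 402, hyperquadrics of
`ℝ⁴₁`, stretched in time). [cite: ONeillSemiRiemannian1983, Ch. 14, p. 402] -/
theorem mem_stretchLeaf_iff (a : ℝ) (y : E4) :
    y ∈ stretchLeaf a ↔ y 0 = a * √(1 + ‖E4.spatial y‖ ^ 2) := by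
  constructor
  · rintro ⟨x, hx, rfl⟩
    rw [ModelBackground.mem_timeSlab, hypTime_eq, sub_eq_zero] at hx
    rw [stretchChart_apply, timeStretch_apply_zero, spatial_timeStretch, hx]
  · intro hy
    have h : y = E4.ofTimeSpace (a * √(1 + ‖E4.spatial y‖ ^ 2)) (E4.spatial y) := by
      rw [← hy]
      exact (E4.ofTimeSpace_time_spatial y).symm
    rw [h]
    exact ofTimeSpace_mem_stretchLeaf a _

/-- The tip `(a, 0̲)` of the stretched leaf lies on it. [folklore] -/
theorem ofTimeSpace_zero_mem_stretchLeaf (a : ℝ) : E4.ofTimeSpace a 0 ∈ stretchLeaf a := by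
  have h := ofTimeSpace_mem_stretchLeaf a (0 : E3)
  rwa [norm_zero, zero_pow two_ne_zero, add_zero, Real.sqrt_one, mul_one] at h

/-! ### Fast receding inertial observers never meet the stretched leaf -/

/-- **Dodging.** For `a > 1`, a straight timelike world-line `t ↦ (t, x̲₀ + t V)` whose speed
exceeds `1/a` (`1 < a ‖V‖`; speeds `< 1` are allowed since `a > 1`) and which recedes from the axis
(`0 ≤ ⟪x̲₀, V⟫`) never meets the stretched leaf `{y⁰ = a √(1 + |y̲|²)}`: for `t ≤ 0` the leaf time over
any point is `≥ a > 0 ≥ t`; for `t > 0`, `|x̲₀ + tV|² = |x̲₀|² + 2t⟪x̲₀,V⟫ + t²‖V‖² ≥ t² ‖V‖²`, so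
`a √(1 + |x̲₀ + tV|²) > a |x̲₀ + tV| ≥ a t ‖V‖ > t`. The leaf rises superluminally beyond coordinate
radius `(a² − 1)^{-1/2}` and outruns the observer. O'Neill 1983, Ch. 14, p. 402 (coordinates of
`ℝ⁴₁`). [cite: ONeillSemiRiemannian1983, Ch. 14, p. 402] -/
theorem line_not_mem_stretchLeaf {a : ℝ} (ha : 1 < a) {x₀ V : E3} (hV : 1 < a * ‖V‖)
    (hx₀ : 0 ≤ inner ℝ x₀ V) (t : ℝ) : E4.ofTimeSpace t (x₀ + t • V) ∉ stretchLeaf a := by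
  rw [mem_stretchLeaf_iff, E4.ofTimeSpace_apply_zero, E4.spatial_ofTimeSpace]
  intro h
  set w : E3 := x₀ + t • V with hw
  have ha0 : 0 < a := one_pos.trans ha
  have hs : ‖w‖ < √(1 + ‖w‖ ^ 2) := (Real.lt_sqrt (norm_nonneg _)).2 (by nlinarith)
  have hspos : 0 < √(1 + ‖w‖ ^ 2) := (norm_nonneg _).trans_lt hs
  rcases le_or_gt t 0 with ht | ht
  · -- `t ≤ 0 < a √(1 + |w|²)`
    have : 0 < a * √(1 + ‖w‖ ^ 2) := mul_pos ha0 hspos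
    linarith
  · -- `t > 0`: `|w| ≥ t ‖V‖`
    have hsq : (t * ‖V‖) ^ 2 ≤ ‖w‖ ^ 2 := by
      have h1 : ‖w‖ ^ 2 = ‖x₀‖ ^ 2 + 2 * inner ℝ x₀ (t • V) + ‖t • V‖ ^ 2 := by
        rw [hw]; exact norm_add_sq_real x₀ (t • V)
      have h2 : inner ℝ x₀ (t • V) = t * inner ℝ x₀ V := real_inner_smul_right x₀ V t
      have h3 : ‖t • V‖ = t * ‖V‖ := by
        rw [norm_smul, Real.norm_eq_abs, abs_of_pos ht]
      rw [h1, h2, h3]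
      nlinarith [sq_nonneg ‖x₀‖, mul_nonneg ht.le hx₀]
    have htV : t * ‖V‖ ≤ ‖w‖ :=
      (pow_le_pow_iff_left₀ (by positivity) (norm_nonneg _) two_ne_zero).1 hsq
    -- `t = a √(1+|w|²) > a |w| ≥ a t ‖V‖ > t`
    have h4 : a * ‖w‖ < a * √(1 + ‖w‖ ^ 2) := mul_lt_mul_of_pos_left hs ha0
    have h5 : a * (t * ‖V‖) ≤ a * ‖w‖ := mul_le_mul_of_nonneg_left htV ha0.le
    have h6 : t < t * (a * ‖V‖) := lt_mul_right ht hV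
    nlinarith

/-- **The same observer is eventually in the chronological future of the leaf**: if `‖V‖ < 1`, then
for `t (1 − ‖V‖) > a + ‖x̲₀‖` the event `(t, x̲₀ + tV)` lies in `I⁺` of the tip `(a, 0̲) ∈ stretchLeaf a`
(straight timelike segment: `|x̲₀ + tV| ≤ ‖x̲₀‖ + t ‖V‖ < t − a`). So the dodged observer is not
"before" the leaf: it lives in `I⁺(S)` from some time on and still never crosses `S` — possible only
because the leaf is not achronal. O'Neill 1983, Ch. 14, p. 402. [cite: ONeillSemiRiemannian1983, Ch. 14, p. 402] -/
theorem line_mem_chronologicalFuture_stretchLeaf (a : ℝ) {x₀ V : E3} {t : ℝ} (ht : 0 ≤ t)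
    (hT : a + ‖x₀‖ < t * (1 - ‖V‖)) :
    E4.ofTimeSpace t (x₀ + t • V) ∈ (vacuumCauchyDevelopment.metric.chronologicalFuture
      vacuumCauchyDevelopment.timeOrientation (stretchLeaf a) : Set E4) := by
  refine LorentzianMetric.chronologicalFuture_mono (g := vacuumCauchyDevelopment.metric)
    (singleton_subset_iff.2 (ofTimeSpace_zero_mem_stretchLeaf a))
    (mem_chronologicalFuture_of_norm_lt ?_)
  rw [E4.spatial_ofTimeSpace, E4.spatial_ofTimeSpace, E4.ofTimeSpace_apply_zero,
    E4.ofTimeSpace_apply_zero, sub_zero]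
  have h1 : ‖x₀ + t • V‖ ≤ ‖x₀‖ + t * ‖V‖ := by
    refine (norm_add_le _ _).trans ?_
    rw [norm_smul, Real.norm_eq_abs, abs_of_nonneg ht]
  nlinarith

/-- Every event of non-negative time lies in the causal future of the data slice `{x⁰ = 0}` of the
Minkowski development (vertical segment from `(0, y̲)`). O'Neill 1983, Ch. 14, p. 402. [cite: ONeillSemiRiemannian1983, Ch. 14, p. 402] -/
theorem ofTimeSpace_mem_causalFuture_range_embed {t : ℝ} (ht : 0 ≤ t) (y : E3) :
    E4.ofTimeSpace t y ∈ vacuumCauchyDevelopment.metric.causalFuture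
      vacuumCauchyDevelopment.timeOrientation
      (range vacuumCauchyDevelopment.toCauchyDevelopment.embed) := by
  set p : E4 := E4.ofTimeSpace 0 y with hp
  have hpr : p ∈ range vacuumCauchyDevelopment.toCauchyDevelopment.embed := by
    change p ∈ range sliceEmbed
    rw [E4.mem_range_sliceEmbed_iff]
    simp [hp]
  refine LorentzianMetric.causalFuture_mono (g := vacuumCauchyDevelopment.metric)
    (singleton_subset_iff.2 hpr) (mem_causalFuture_vacuumCauchyDevelopment ?_)
  rw [hp, E4.spatial_ofTimeSpace, E4.spatial_ofTimeSpace, sub_self, norm_zero,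
    E4.ofTimeSpace_apply_zero, E4.ofTimeSpace_apply_zero, sub_zero]
  exact ht

/-! ### Packaged: a near-Kerr leaf missed by an honest inertial observer -/

/-- **A near-Kerr leaf need not be crossed by every inertial observer in its future.** For every
order `k` and tolerance `ε > 0` there are an `(ε, k)`-near-Kerr leaf `S` of the Minkowski development
with `0` holes (the stretched hyperboloid with `s = min ε 1`, `a = √(1+s)`) and a straight timelike
world-line `γ(t) = (t, t V)` of speed `‖V‖ = 2/(1+a) < 1` through the origin such that: `γ` never
meets `S`; `γ(t) ∈ J⁺(ι ℝ³)` for `t ≥ 0`; `γ(t) ∈ J⁻(S)` for all `t`; and `γ(t) ∈ I⁺(S)` for all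
`t ≥ T`. Hence the conclusion form `∃ S', IsNearKerrLeaf k ε 0 … S'` of a route item certifies no
"sweeping" of late observers by `S'` (crux dossier ADDENDUM-a1, question (Q): answered in the
negative), and a repaired leaf predicate must add achronality of `S'` or a frame-adapted deviation.
O'Neill 1983, Ch. 14, p. 402; DHRT arXiv:2104.08222, §1. [cite: ONeillSemiRiemannian1983, Ch. 14, p. 402] -/
theorem exists_isNearKerrLeaf_missed_by_inertialObserver (k : ℕ) {ε : ℝ≥0∞} (hε : 0 < ε) :
    ∃ S : Set E4, vacuumCauchyDevelopment.toCauchyDevelopment.IsNearKerrLeaf k ε 0 ![] ![] S ∧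
      ∃ V : E3, ‖V‖ < 1 ∧
        (∀ t : ℝ, E4.ofTimeSpace t (t • V) ∉ S) ∧
        (∀ t : ℝ, 0 ≤ t → E4.ofTimeSpace t (t • V) ∈
          vacuumCauchyDevelopment.metric.causalFuture vacuumCauchyDevelopment.timeOrientation
            (range vacuumCauchyDevelopment.toCauchyDevelopment.embed)) ∧
        (∀ t : ℝ, E4.ofTimeSpace t (t • V) ∈
          (vacuumCauchyDevelopment.metric.causalPast vacuumCauchyDevelopment.timeOrientation S :
            Set E4)) ∧
        ∃ T : ℝ, ∀ t : ℝ, T ≤ t → E4.ofTimeSpace t (t • V) ∈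
          (vacuumCauchyDevelopment.metric.chronologicalFuture vacuumCauchyDevelopment.timeOrientation
            S : Set E4) := by
  have hne : min ε 1 ≠ ⊤ := (min_le_right _ _).trans_lt ENNReal.one_lt_top |>.ne
  set s : ℝ := (min ε 1).toReal with hs_def
  have h0 : 0 < s := ENNReal.toReal_pos (lt_min hε one_pos).ne' hne
  set a : ℝ := √(1 + s) with ha_def
  have ha : 1 < a := (Real.lt_sqrt zero_le_one).2 (by nlinarith)
  have ha0 : 0 < a := one_pos.trans ha
  -- the leaf
  have hleaf : vacuumCauchyDevelopment.toCauchyDevelopment.IsNearKerrLeaf k ε 0 ![] ![]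
      (stretchLeaf a) := by
    refine (isNearKerrLeaf_stretchLeaf k h0).mono le_rfl ?_
    rw [hs_def, ENNReal.ofReal_toReal hne]
    exact min_le_left _ _
  -- the observer: speed `v = 2/(1+a) ∈ (1/a, 1)` along `e₁`
  set e : E3 := EuclideanSpace.single (0 : Fin 3) (1 : ℝ) with he
  have hne1 : ‖e‖ = 1 := by simp [he]
  set v : ℝ := 2 / (1 + a) with hv
  have hv0 : 0 < v := by rw [hv]; positivity
  have hv1 : v < 1 := by rw [hv, div_lt_one (by linarith)]; linarith
  have hav : 1 < a * v := by
    rw [hv, ← mul_div_assoc, one_lt_div (by linarith)]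
    linarith
  set V : E3 := v • e with hV
  have hnV : ‖V‖ = v := by
    rw [hV, norm_smul, hne1, mul_one, Real.norm_eq_abs, abs_of_pos hv0]
  refine ⟨stretchLeaf a, hleaf, V, by rw [hnV]; exact hv1, fun t => ?_, fun t ht => ?_,
    fun t => mem_causalPast_stretchLeaf ha _, ⟨(a + 1) / (1 - v), fun t ht => ?_⟩⟩
  · -- never meets the leaf
    have h := line_not_mem_stretchLeaf ha (x₀ := 0) (V := V) (by rw [hnV]; exact hav)
      (by rw [inner_zero_left]) t
    rwa [zero_add] at h
  · -- in `J⁺` of the data slice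
    exact ofTimeSpace_mem_causalFuture_range_embed ht _
  · -- eventually in `I⁺(S)`
    have h1v : 0 < 1 - v := by linarith
    have htpos : 0 ≤ t := by
      have : 0 ≤ (a + 1) / (1 - v) := by positivity
      linarith
    have hT : a + ‖(0 : E3)‖ < t * (1 - ‖V‖) := by
      rw [norm_zero, add_zero, hnV]
      have := (div_le_iff₀ h1v).1 ht
      linarith
    have h := line_mem_chronologicalFuture_stretchLeaf a (x₀ := 0) (V := V) htpos hT
    rwa [zero_add] at h

end Minkowski

end Literature.Geometry.Lorentzian

end
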